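import Literature.Probability.Percolation.QuadCrossingSquareModel
import Literature.Probability.Percolation.QuadCrossingPathCrossings
import Literature.Probability.Percolation.QuadCrossingRotationInvarianceOfTransfer
import HarnessLib

/-!
# DKKMO Cor. 1.3 (`q = 1`) from the Schramm–Smirnov half of Theorem 1.2 and the continuity of
# crossing events (proved reduction)

Topic `Probability/Percolation`; proofs file of `QuadCrossingRotationInvariance.lean`, whose named
fact `dkkmo_crossing_rotation_invariance` vendors Duminil-Copin–Kozlowski–Krachun–Manolescu–
Oulamara, arXiv:2012.11672v1, Corollary 1.3 at `q = 1` (per quad `Q` and `ε > 0`: for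
`α ∈ (ε, π - ε)` and `δ < δ₀(Q, ε)`, `|P_{1/2}[𝒞_δ(e^{iα}Q)] - P_{1/2}[𝒞_δ(Q)]| ≤ ε`).

The printed proof (§1.3: "the definition of the Schramm-Smirnov topology implies, in particular,
that crossing probabilities are invariant under rotation"; §7.1 p. 43: "follows directly from
Theorem 1.2 and the measurability of `𝒞(Q)` in the Schramm–Smirnov topology") uses

1. the Schramm–Smirnov (`d_SS`) half of Theorem 1.2 — a coupling of `ω_δ ∼ φ_{δℤ²}` and
   `ω'_δ` with `ℙ[d_SS(ω_δ, e^{iα}ω'_δ) > ε] < ε`, `d_SS` "the metric (whose definition is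
   implicit)" of the compact metrizable space `𝔥` of closed hereditary sets of quads (§1.2) — NOT
   in the tree (`LoopRepresentation.lean` vendors only the Camia–Newman half `dkkmo_theorem_1_2`,
   which does not control the crossing of a fixed quad: two configurations with `η`-close typed
   loop ensembles may cross no, resp. every, macroscopic quad of a region, e.g. a fine dual mesh
   with small open islands against a fine open mesh with small dual islands inside matching thin
   rings), and
2. the continuity of the crossing event `⊞_Q` of a fixed quad in `𝔥` under the percolation laws
   (Schramm–Smirnov, Ann. Probab. 39 (2011), Lemma 5.1, from the RSW continuity Lemma 6.1 through
   the discrete estimate (5.1)).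

`dkkmo_crossing_rotation_invariance_of_schrammSmirnov` proves the corollary from these two
inputs taken as explicit hypotheses of the precise shape the tree can supply: `hSS` is input 1 on
the tree's Schramm–Smirnov space (`QuadCrossingSpace univ`, `z2QuadConfig`, `QuadConfig.rotate`),
metric-free (for every open neighbourhood of the diagonal; equivalent to the printed form for any
metric inducing the topology, by compactness — Schramm–Smirnov Thm. 1.4, proved in the tree), and
`hcont` is LITERALLY the hypothesis of `QuadCrossing.SchrammSmirnov2011_lemma_5_1_of_continuity`
at `D = univ` (the discrete (5.1): `Q' < Q₀ < Q''` with
`P_{1/2}[Q' crossed inside the open edges ∧ Q'' not] ≤ ε` for small meshes), so that one proof of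
(5.1) for bond percolation on `δℤ²` serves both Schramm–Smirnov's Lemma 5.1 and this corollary;
`dkkmo_crossing_rotation_invariance_of_schrammSmirnov_dist` takes input 1 in the printed form
`ℙ[d_SS > ε] < ε` for any (continuous, separating) `d_SS` instead and derives the metric-free form.
No named fact is introduced (D-0026); `dkkmo_theorem_1_2` is not used.

Ingredients from the tree: square models of a conformal rectangle (`QuadCrossingSquareModel`:
`exists_isSquareModel`), turned here into a parametrised quad `squareModelQuad Φ ∈ 𝒬_ℂ` with
the right carrier and sides; the bridge `quadCrossing R δ ⊆ {Q ∈ S_ω}`,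
`{Q₁ ∈ S_ω} ⊆ quadCrossing R δ` (`Q < Q₁`) and its rotated forms (`QuadCrossingPathCrossings`);
the `𝔥`-topology of Schramm–Smirnov's proof of Lemma 5.1 (`closure_notCrossed_subset`,
`Quad.exists_strictlyDominated_between`, `Quad.mem_closure_setOf_strictlyDominated`,
`Quad.exists_isCrossing_of_mem_closure`, from `QuadCrossingContinuityEventsProofs` /
`QuadCrossingSpaceProofs`); the coupling inequality and angle bookkeeping
(`dkkmo_crossing_rotation_invariance_of_coupling`). KEY POINT of the assembly: both boundary error
terms are charged to the UNROTATED configuration, so no uniformity of the continuity estimate over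
the rotations of the quad is required (unlike a transfer through `d_CN`).

## References

* [DKKMO2020Rotational] H. Duminil-Copin, K. K. Kozlowski, D. Krachun, I. Manolescu,
  M. Oulamara, arXiv:2012.11672v1 (2020): §1.2 p. 4 (`𝔥`, `d_SS`), Thm. 1.2 and Cor. 1.3 p. 5,
  §1.3, §7.1 p. 43.
* [SchrammSmirnov2011] O. Schramm, S. Smirnov, Ann. Probab. 39 (2011), arXiv:1101.5820, §1.3,
  Thm. 1.4, §5 (Lemma 5.1, (5.1)), §6 (Lemma 6.1).
-/

noncomputable section

open Set Filter
open _root_.MeasureTheory _root_.Topology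
open scoped ENNReal unitInterval symmDiff
open Literature.Probability.LatticeModels Literature.Probability.RandomPlanarGeometry

namespace Literature.Probability.Percolation

open QuadCrossing


/-! ### The quad of a conformal rectangle in Schramm–Smirnov's space `𝒬_ℂ` -/

/-- The affine chart of the model square `[-1, 1]²` by `[0, 1]²` used to parametrise quads:
`(s, t) ↦ (1 - 2t) + (-1 + 2s) i`, so that `{s = 0}` goes to the bottom side, `{s = 1}` to the
top side, `{t = 0}` to the right side and `{t = 1}` to the left side. [folklore] -/
def unitSquareChart (z : I × I) : ℂ := ⟨1 - 2 * (z.2 : ℝ), -1 + 2 * (z.1 : ℝ)⟩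

/-- The chart is continuous. [folklore] -/
theorem continuous_unitSquareChart : Continuous unitSquareChart := by
  unfold unitSquareChart
  refine Continuous.comp (f := fun z : I × I => ((1 - 2 * (z.2 : ℝ)), (-1 + 2 * (z.1 : ℝ))))
    (g := fun p : ℝ × ℝ => (⟨p.1, p.2⟩ : ℂ)) ?_ (by fun_prop)
  exact Complex.equivRealProdCLM.symm.continuous

/-- The chart is injective. [folklore] -/
theorem injective_unitSquareChart : Function.Injective unitSquareChart := by
  rintro ⟨s, t⟩ ⟨s', t'⟩ h
  have h1 := congrArg Complex.re h
  have h2 := congrArg Complex.im h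
  simp only [unitSquareChart] at h1 h2
  refine Prod.ext (Subtype.ext ?_) (Subtype.ext ?_)
  · change (s : ℝ) = s'; linarith
  · change (t : ℝ) = t'; linarith

/-- The chart maps `[0, 1]²` onto the closed model square `[-1, 1]²`. [folklore] -/
theorem range_unitSquareChart : range unitSquareChart = Icc (-1 : ℝ) 1 ×ℂ Icc (-1 : ℝ) 1 := by
  ext w
  rw [Complex.mem_reProdIm, mem_range]
  constructor
  · rintro ⟨⟨s, t⟩, rfl⟩
    have hs := s.2; have ht := t.2
    simp only [mem_Icc] at hs ht
    simp only [unitSquareChart, mem_Icc]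
    exact ⟨⟨by linarith, by linarith⟩, by linarith, by linarith⟩
  · rintro ⟨⟨h1, h2⟩, h3, h4⟩
    refine ⟨(⟨(w.im + 1) / 2, ⟨by linarith, by linarith⟩⟩, ⟨(1 - w.re) / 2, ⟨by linarith, by linarith⟩⟩), ?_⟩
    apply Complex.ext <;> simp only [unitSquareChart] <;> ring

/-- **The quad of a square model** `Φ`: `Φ ∘ unitSquareChart ∈ 𝒬_ℂ`, a parametrised quad
(Schramm–Smirnov's "homeomorphism `Q : [0,1]² → Q([0,1]²)`"). For a square model `Φ` of the
conformal rectangle `R` its image is the closed quad of `R` and its sides `∂₀`, `∂₂` are the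
arcs `R.arc 0`, `R.arc 2` (`IsSquareModel.carrier_squareModelQuad`, `….side_zero_squareModelQuad`,
`….side_two_squareModelQuad`). [cite: SchrammSmirnov2011, §1.3] -/
def squareModelQuad (Φ : ℂ ≃ₜ ℂ) : Quad (univ : Set ℂ) where
  toFun z := Φ (unitSquareChart z)
  continuous_toFun := Φ.continuous.comp continuous_unitSquareChart
  injective_toFun := Φ.injective.comp injective_unitSquareChart
  range_subset := subset_univ _

/-- `squareModelQuad_apply`: structural lemma. [folklore] -/
@[simp] theorem squareModelQuad_apply (Φ : ℂ ≃ₜ ℂ) (z : I × I) :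
    squareModelQuad Φ z = Φ (unitSquareChart z) := rfl

namespace IsSquareModel

variable {R : ConformalRectangle} {Φ : ℂ ≃ₜ ℂ} (h : IsSquareModel R Φ)
include h

/-- The carrier of the quad of a square model of `R` is the closed quad. [cite: SchrammSmirnov2011, §1.3] -/
theorem carrier_squareModelQuad : (squareModelQuad Φ).carrier = closure R.carrier := by
  rw [Quad.carrier, show ((squareModelQuad Φ : Quad (univ : Set ℂ)) : I × I → ℂ) = Φ ∘ unitSquareChart from rfl,
    range_comp, range_unitSquareChart, h.image_Icc]

/-- Side `0` of the quad of a square model of `R` is the arc `R.arc 0`. [cite: SchrammSmirnov2011, §1.3] -/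
theorem side_zero_squareModelQuad : (squareModelQuad Φ).side 0 = R.arc 0 := by
  rw [← h.image_arc 0]
  change (fun z => Φ (unitSquareChart z)) '' {z : I × I | z.1 = 0} = Φ '' unitSquareQuad.arc 0
  rw [← image_image (g := Φ) (f := unitSquareChart)]
  congr 1
  ext w
  rw [SquareModel.mem_arc_zero, mem_image]
  constructor
  · rintro ⟨⟨s, t⟩, hs, rfl⟩
    have hs0 : (s : ℝ) = 0 := by exact_mod_cast congrArg Subtype.val hs
    have ht := t.2
    simp only [mem_Icc] at ht
    simp only [unitSquareChart, mem_Icc, hs0]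
    exact ⟨by ring, by linarith, by linarith⟩
  · rintro ⟨hw, h1, h2⟩
    refine ⟨(0, ⟨(1 - w.re) / 2, ⟨by linarith, by linarith⟩⟩), rfl, ?_⟩
    apply Complex.ext <;> simp only [unitSquareChart, Set.Icc.coe_zero] <;> [ring; (rw [hw]; ring)]

/-- Side `2` of the quad of a square model of `R` is the arc `R.arc 2`. [cite: SchrammSmirnov2011, §1.3] -/
theorem side_two_squareModelQuad : (squareModelQuad Φ).side 2 = R.arc 2 := by
  rw [← h.image_arc 2]
  change (fun z => Φ (unitSquareChart z)) '' {z : I × I | z.1 = 1} = Φ '' unitSquareQuad.arc 2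
  rw [← image_image (g := Φ) (f := unitSquareChart)]
  congr 1
  ext w
  rw [SquareModel.mem_arc_two, mem_image]
  constructor
  · rintro ⟨⟨s, t⟩, hs, rfl⟩
    have hs1 : (s : ℝ) = 1 := by exact_mod_cast congrArg Subtype.val hs
    have ht := t.2
    simp only [mem_Icc] at ht
    simp only [unitSquareChart, mem_Icc, hs1]
    exact ⟨by ring, by linarith, by linarith⟩
  · rintro ⟨hw, h1, h2⟩
    refine ⟨(1, ⟨(1 - w.re) / 2, ⟨by linarith, by linarith⟩⟩), rfl, ?_⟩
    apply Complex.ext <;> simp only [unitSquareChart, Set.Icc.coe_one] <;> [ring; (rw [hw]; ring)]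

end IsSquareModel

/-! ### DKKMO Cor. 1.3 (`q = 1`) from the Schramm–Smirnov half of Theorem 1.2 and continuity -/

/-- **DKKMO's Corollary 1.3 at `q = 1` from the Schramm–Smirnov (`d_SS`) half of their
Theorem 1.2 and Schramm–Smirnov's continuity of crossing events** — the printed proof line
(arXiv:2012.11672v1, §1.3: "the definition of the Schramm-Smirnov topology implies, in
particular, that crossing probabilities are invariant under rotation"; §7.1 p. 43: "follows
directly from Theorem 1.2 and the measurability of `𝒞(Q)` in the Schramm–Smirnov topology"),
with its two inputs as explicit hypotheses (no named fact is introduced):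

* `hSS` — Theorem 1.2, `d_SS` part, `q = 1`, infinite volume, rendered metric-free on the tree's
  Schramm–Smirnov space `𝔥 = QuadCrossingSpace univ` ("`d_SS`, the metric whose definition is
  implicit"): for every `ε > 0` and every open neighbourhood `N` of the diagonal of `𝔥 × 𝔥` there
  is `δ₀ > 0` such that for all `α ∈ (ε, π - ε)`, `0 < δ ≤ δ₀` some coupling `ℙ` of two critical
  bond percolations has `ℙ[(S_{ω_δ}, e^{iα} · S_{ω'_δ}) ∉ N] < ε`, where `S_ω = z2QuadConfig univ δ ω`
  and `e^{iα} · S = QuadConfig.rotate α S` is the encoding of the sample drawn on `e^{iα}δℤ²`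
  (equivalent to the printed `ℙ[d_SS > ε] < ε` for any metric inducing the topology, `𝔥` being
  compact);
* `hcont` — the continuity of the crossing event of a fixed quad under critical bond percolation
  on `δℤ²`, in the discrete form (5.1) of Schramm–Smirnov (Ann. Probab. 39 (2011), proof of
  Lemma 5.1, from their RSW Lemma 6.1): for every quad `Q₀ ∈ 𝒬_ℂ` and `ε > 0` there are quads
  `Q' < Q₀ < Q''` and `δ₀ > 0` with `P_{1/2}[Q' crossed inside the open edges of δℤ² ∧ Q'' not] ≤ ε`
  for `0 < δ < δ₀` — literally the hypothesis of `SchrammSmirnov2011_lemma_5_1_of_continuity`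
  at `D = univ`.

Proof. Fix `R`, `ε`; let `Q ∈ 𝒬_ℂ` be the quad of `R` (square model, `squareModelQuad`),
take `Q' < Q < Q''` and `δ_c` from `hcont` at `ε/3`, and quads `Q' < Qm < Q < Q₁ < Q₂ < Q''`
(`Quad.exists_strictlyDominated_between`). In `𝔥` let `K₁ = closure V^{Q₁} ⊆ O₁ = V^{Q₂}`
(`closure_notCrossed_subset`) and `K₂ = ⊞_Q ⊆ O₂ = V_U ⊆ ⊞_{Qm}`, `U = {Qm < · < Q₁}`, and
`N = {(S, S') : (S' ∈ K₁ → S ∈ O₁) ∧ (S' ∈ K₂ → S ∈ O₂)}`, an open neighbourhood of the diagonal.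
Under the coupling of `hSS` at `(ε/3, N)`: if `ω` crosses `R` but `ω'` does not cross `e^{-iα}R`
then `Q ∈ S_ω` (`quadCrossing_subset_setOf_mem_z2QuadConfig`) and `Q₁ ∉ e^{iα}·S_{ω'}`
(`subset_quadCrossing_rotateQuad_neg`), so on `N`, `Q₂ ∉ S_ω`; if `ω'` crosses but `ω` does not,
then `Q ∈ e^{iα}·S_{ω'}` and `Q₁ ∉ S_ω`, so on `N`, `Qm ∈ S_ω`. In both cases `ω` lies in
`E = {Q' raw-crossed ∧ Q'' not}` (`Quad.exists_isCrossing_of_mem_closure`, lower sets), an event of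
the UNROTATED marginal of probability `≤ ε/3`; with `ℙ[∉ N] < ε/3` the crossing indicators disagree
with probability `≤ ε`, uniformly in `α ∈ (ε, π - ε)` and `δ < min δ₀ δ_c`, and
`dkkmo_crossing_rotation_invariance_of_coupling` (coupling inequality + half-turn symmetry)
concludes. No uniformity of the continuity estimate over rotations of the quad is needed.
[cite: DKKMO2020Rotational, Cor. 1.3 (q = 1), proof §7.1 p. 43; Thm. 1.2] -/
theorem dkkmo_crossing_rotation_invariance_of_schrammSmirnov
    (hSS : ∀ ε : ℝ, 0 < ε →
      ∀ N : Set (QuadCrossingSpace (univ : Set ℂ) × QuadCrossingSpace (univ : Set ℂ)), IsOpen N →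
        (∀ S, (S, S) ∈ N) →
        ∃ δ₀ : ℝ, 0 < δ₀ ∧ ∀ α ∈ Set.Ioo ε (Real.pi - ε), ∀ δ : ℝ, 0 < δ → δ ≤ δ₀ →
          ∃ P : Measure (BondConfig (Site 2) × BondConfig (Site 2)),
            P.map Prod.fst = bondPercolation (zdGraph 2) half ∧
            P.map Prod.snd = bondPercolation (zdGraph 2) half ∧
            P {p | (z2QuadConfig univ δ p.1, QuadConfig.rotate α (z2QuadConfig univ δ p.2)) ∉ N} <
              ENNReal.ofReal ε)
    (hcont : ∀ (Q₀ : Quad (univ : Set ℂ)) (ε : ℝ≥0∞), 0 < ε →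
      ∃ Q' Q'' : Quad (univ : Set ℂ), Quad.StrictlyDominated Q' Q₀ ∧ Quad.StrictlyDominated Q₀ Q'' ∧
        ∃ δ₀ : ℝ, 0 < δ₀ ∧ ∀ δ : ℝ, 0 < δ → δ < δ₀ →
          bondPercolation (zdGraph 2) half
            {ω | (∃ K, Q'.IsCrossing K ∧ K ⊆ openEdgeUnion δ ω) ∧
              ¬ ∃ K, Q''.IsCrossing K ∧ K ⊆ openEdgeUnion δ ω} ≤ ε) :
    dkkmo_crossing_rotation_invariance := by
  refine dkkmo_crossing_rotation_invariance_of_coupling fun R ε hε => ?_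
  -- the quad of `R`
  obtain ⟨Φ, hΦ⟩ := exists_isSquareModel R
  have hc : (squareModelQuad Φ).carrier = closure R.carrier := hΦ.carrier_squareModelQuad
  have h0 : (squareModelQuad Φ).side 0 = R.arc 0 := hΦ.side_zero_squareModelQuad
  have h2 : (squareModelQuad Φ).side 2 = R.arc 2 := hΦ.side_two_squareModelQuad
  set Q : Quad (univ : Set ℂ) := squareModelQuad Φ
  -- continuity at `Q`, with `ε/3`
  have hε3 : 0 < ε / 3 := by positivity
  obtain ⟨Q', Q'', hQ'Q, hQQ'', δc, hδc, hE⟩ :=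
    hcont Q (ENNReal.ofReal (ε / 3)) (ENNReal.ofReal_pos.2 hε3)
  -- intermediate quads `Q' < Qm < Q < Q₁ < Q₂ < Q''`
  obtain ⟨Qm, hQ'Qm, hQmQ⟩ := Quad.exists_strictlyDominated_between isOpen_univ hQ'Q
  obtain ⟨Q₁, hQQ₁, hQ₁Q''⟩ := Quad.exists_strictlyDominated_between isOpen_univ hQQ''
  obtain ⟨Q₂, hQ₁Q₂, hQ₂Q''⟩ := Quad.exists_strictlyDominated_between isOpen_univ hQ₁Q''
  -- the sets of the neighbourhood of the diagonal
  have hU : IsOpen {P : Quad (univ : Set ℂ) | Quad.StrictlyDominated Qm P ∧ Quad.StrictlyDominated P Q₁} :=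
    (Quad.isOpen_setOf_strictlyDominated_right Qm).inter (Quad.isOpen_setOf_strictlyDominated_left Q₁)
  have hK₁O₁ : closure (QuadConfig.notCrossed Q₁) ⊆ QuadConfig.notCrossed Q₂ :=
    QuadConfig.closure_notCrossed_subset isOpen_univ hQ₁Q₂
  have hK₂O₂ : QuadConfig.crossedEvent Q ⊆
      QuadConfig.someCrossed {P | Quad.StrictlyDominated Qm P ∧ Quad.StrictlyDominated P Q₁} := by
    intro S hS
    obtain ⟨P, ⟨hQmP, hPQ₁⟩, hPQ⟩ := mem_closure_iff.mp
      (Quad.mem_closure_setOf_strictlyDominated isOpen_univ Q) _ hU ⟨hQmQ, hQQ₁⟩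
    exact ⟨P, S.isLowerQuadSet hS hPQ, hQmP, hPQ₁⟩
  have hO₂sub : QuadConfig.someCrossed {P | Quad.StrictlyDominated Qm P ∧ Quad.StrictlyDominated P Q₁} ⊆
      QuadConfig.crossedEvent Qm := fun S ⟨P, hPS, hQmP, _⟩ => S.isLowerQuadSet hPS hQmP
  -- the neighbourhood `N`
  obtain ⟨N, hNopen, hNdiag, hN₁, hN₂⟩ : ∃ N : Set (QuadCrossingSpace (univ : Set ℂ) ×
      QuadCrossingSpace (univ : Set ℂ)), IsOpen N ∧ (∀ S, (S, S) ∈ N) ∧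
      (∀ p ∈ N, p.2 ∈ closure (QuadConfig.notCrossed Q₁) → p.1 ∈ QuadConfig.notCrossed Q₂) ∧
      (∀ p ∈ N, p.2 ∈ QuadConfig.crossedEvent Q →
        p.1 ∈ QuadConfig.someCrossed {P | Quad.StrictlyDominated Qm P ∧ Quad.StrictlyDominated P Q₁}) := by
    refine ⟨((univ ×ˢ (closure (QuadConfig.notCrossed Q₁))ᶜ) ∪ (QuadConfig.notCrossed Q₂ ×ˢ univ)) ∩
      ((univ ×ˢ (QuadConfig.crossedEvent Q)ᶜ) ∪
        (QuadConfig.someCrossed {P | Quad.StrictlyDominated Qm P ∧ Quad.StrictlyDominated P Q₁} ×ˢ univ)),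
      ?_, fun S => ⟨?_, ?_⟩, ?_, ?_⟩
    · exact ((isOpen_univ.prod isClosed_closure.isOpen_compl).union
        ((QuadConfig.isOpen_notCrossed Q₂).prod isOpen_univ)).inter
        ((isOpen_univ.prod (QuadConfig.isClosed_crossedEvent Q).isOpen_compl).union
          ((QuadConfig.isOpen_someCrossed hU).prod isOpen_univ))
    · by_cases hS : S ∈ closure (QuadConfig.notCrossed Q₁)
      · exact Or.inr ⟨hK₁O₁ hS, mem_univ _⟩
      · exact Or.inl ⟨mem_univ _, hS⟩
    · by_cases hS : S ∈ QuadConfig.crossedEvent Q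
      · exact Or.inr ⟨hK₂O₂ hS, mem_univ _⟩
      · exact Or.inl ⟨mem_univ _, hS⟩
    · rintro p ⟨hp, -⟩ hp2
      rcases hp with ⟨-, hp'⟩ | ⟨hp', -⟩
      · exact absurd hp2 hp'
      · exact hp'
    · rintro p ⟨-, hp⟩ hp2
      rcases hp with ⟨-, hp'⟩ | ⟨hp', -⟩
      · exact absurd hp2 hp'
      · exact hp'
  -- the coupling from the Schramm–Smirnov half of Theorem 1.2, with `ε/3`
  obtain ⟨δs, hδs, hcoup⟩ := hSS (ε / 3) hε3 N hNopen hNdiag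
  refine ⟨min δs δc, lt_min hδs hδc, fun α hα δ hδ => ?_⟩
  have hα' : α ∈ Set.Ioo (ε / 3) (Real.pi - ε / 3) := ⟨by linarith [hα.1], by linarith [hα.2]⟩
  obtain ⟨P, hP1, hP2, hPN⟩ := hcoup α hα' δ hδ.1 (hδ.2.le.trans (min_le_left _ _))
  refine ⟨P, hP1, hP2, ?_⟩
  haveI : IsProbabilityMeasure P := isProbabilityMeasure_of_map_fst hP1
  -- raw crossings from membership in `S_ω`, and their absence
  have hraw : ∀ {ω : BondConfig (Site 2)} {P₁ P₂ : Quad (univ : Set ℂ)},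
      Quad.StrictlyDominated P₁ P₂ → P₂ ∈ z2QuadConfig univ δ ω →
        ∃ K, P₁.IsCrossing K ∧ K ⊆ openEdgeUnion δ ω := by
    intro ω P₁ P₂ hlt hmem
    have hmem' : P₂ ∈ (z2QuadConfig univ δ ω : Set (Quad (univ : Set ℂ))) := hmem
    rw [coe_z2QuadConfig] at hmem'
    exact Quad.exists_isCrossing_of_mem_closure hlt hmem'
  have hnoraw : ∀ {ω : BondConfig (Site 2)} {P₁ : Quad (univ : Set ℂ)},
      Quad.StrictlyDominated P₁ Q'' → P₁ ∉ z2QuadConfig univ δ ω →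
        ¬ ∃ K, Q''.IsCrossing K ∧ K ⊆ openEdgeUnion δ ω := by
    rintro ω P₁ hlt hP₁ ⟨K, hK, hKO⟩
    exact hP₁ ((z2QuadConfig univ δ ω).isLowerQuadSet (mem_z2QuadConfig_of_isCrossing hK hKO) hlt)
  -- the inclusion of events: the difference is charged to `E` on the first coordinate, or off `N`
  have hincl : (Prod.fst ⁻¹' quadCrossing R δ) ∆ (Prod.snd ⁻¹' quadCrossing (rotateQuad (-α) R) δ) ⊆
      Prod.fst ⁻¹' {ω | (∃ K, Q'.IsCrossing K ∧ K ⊆ openEdgeUnion δ ω) ∧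
        ¬ ∃ K, Q''.IsCrossing K ∧ K ⊆ openEdgeUnion δ ω} ∪
      {p | (z2QuadConfig univ δ p.1, QuadConfig.rotate α (z2QuadConfig univ δ p.2)) ∉ N} := by
    rintro ⟨ω, ω'⟩ hp
    by_cases hbad : (z2QuadConfig univ δ ω, QuadConfig.rotate α (z2QuadConfig univ δ ω')) ∈ N
    swap
    · exact Or.inr hbad
    left
    rcases hp with ⟨hA, hB⟩ | ⟨hB, hA⟩
    · -- `ω` crosses `R`, `ω'` does not cross `e^{-iα}R`: `Q ∈ S_ω`, `Q₁ ∉ e^{iα}·S_{ω'}`, so `Q₂ ∉ S_ω`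
      have hS : Q ∈ z2QuadConfig univ δ ω := quadCrossing_subset_setOf_mem_z2QuadConfig hc h0 h2 δ hA
      have hS' : Q₁ ∉ QuadConfig.rotate α (z2QuadConfig univ δ ω') := fun hmem =>
        hB (subset_quadCrossing_rotateQuad_neg hc h0 h2 hQQ₁ α hδ.1 hmem)
      have hO : z2QuadConfig univ δ ω ∈ QuadConfig.notCrossed Q₂ := hN₁ _ hbad (subset_closure hS')
      exact ⟨hraw hQ'Q hS, hnoraw hQ₂Q'' hO⟩
    · -- `ω'` crosses `e^{-iα}R`, `ω` does not cross `R`: `Q ∈ e^{iα}·S_{ω'}`, `Q₁ ∉ S_ω`, so `Qm ∈ S_ω`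
      have hS' : Q ∈ QuadConfig.rotate α (z2QuadConfig univ δ ω') :=
        quadCrossing_rotateQuad_neg_subset hc h0 h2 α δ hB
      have hS : Q₁ ∉ z2QuadConfig univ δ ω := fun hmem =>
        hA (setOf_mem_z2QuadConfig_subset_quadCrossing hc h0 h2 hQQ₁ hδ.1 hmem)
      have hO := hO₂sub (hN₂ _ hbad hS')
      exact ⟨hraw hQ'Qm hO, hnoraw hQ₁Q'' hS⟩
  -- measure bounds
  have hPE : P.real (Prod.fst ⁻¹' {ω | (∃ K, Q'.IsCrossing K ∧ K ⊆ openEdgeUnion δ ω) ∧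
      ¬ ∃ K, Q''.IsCrossing K ∧ K ⊆ openEdgeUnion δ ω}) ≤ ε / 3 := by
    refine (measureReal_preimage_fst_le_of_map_eq hP1 _).trans ?_
    exact ENNReal.toReal_le_of_le_ofReal hε3.le (hE δ hδ.1 (hδ.2.trans_le (min_le_right _ _)))
  have hPBad : P.real {p | (z2QuadConfig univ δ p.1, QuadConfig.rotate α (z2QuadConfig univ δ p.2)) ∉ N} <
      ε / 3 :=
    ENNReal.toReal_lt_of_lt_ofReal hPN
  calc P.real ((Prod.fst ⁻¹' quadCrossing R δ) ∆ (Prod.snd ⁻¹' quadCrossing (rotateQuad (-α) R) δ))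
      ≤ _ := measureReal_mono hincl
    _ ≤ _ := measureReal_union_le _ _
    _ ≤ ε := by linarith

/-- **The same, from the printed (metric) form of the Schramm–Smirnov half of Theorem 1.2.**
For any jointly continuous distance-like function `d` on `𝔥` which is positive off the diagonal
— in particular any metric `d_SS` inducing the topology of `𝔥` — the printed statement "for every
`ε > 0` there is `δ₀ > 0` such that for `α ∈ (ε, π - ε)`, `δ ≤ δ₀` some coupling has
`ℙ[d_SS(ω_δ, e^{iα}ω'_δ) > ε] < ε`" implies the metric-free hypothesis `hSS` of
`dkkmo_crossing_rotation_invariance_of_schrammSmirnov` (`𝔥 × 𝔥` is compact by Schramm–Smirnov's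
Thm. 1.4 (1), `SchrammSmirnov2011_thm_1_4_holds`, so `d` has a positive minimum off any open
neighbourhood of the diagonal; the printed statement at a smaller `ε` only widens the angle
range), hence, with the continuity input `hcont`, the corollary.
[cite: DKKMO2020Rotational, Thm. 1.2 (d_SS part) and Cor. 1.3 (q = 1)] -/
theorem dkkmo_crossing_rotation_invariance_of_schrammSmirnov_dist
    (d : QuadCrossingSpace (univ : Set ℂ) → QuadCrossingSpace (univ : Set ℂ) → ℝ)
    (hdc : Continuous fun p : QuadCrossingSpace (univ : Set ℂ) × QuadCrossingSpace (univ : Set ℂ) => d p.1 p.2)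
    (hdpos : ∀ S S', S ≠ S' → 0 < d S S')
    (hSSd : ∀ ε : ℝ, 0 < ε → ∃ δ₀ : ℝ, 0 < δ₀ ∧ ∀ α ∈ Set.Ioo ε (Real.pi - ε), ∀ δ : ℝ, 0 < δ → δ ≤ δ₀ →
      ∃ P : Measure (BondConfig (Site 2) × BondConfig (Site 2)),
        P.map Prod.fst = bondPercolation (zdGraph 2) half ∧
        P.map Prod.snd = bondPercolation (zdGraph 2) half ∧
        P {p | ε < d (z2QuadConfig univ δ p.1) (QuadConfig.rotate α (z2QuadConfig univ δ p.2))} <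
          ENNReal.ofReal ε)
    (hcont : ∀ (Q₀ : Quad (univ : Set ℂ)) (ε : ℝ≥0∞), 0 < ε →
      ∃ Q' Q'' : Quad (univ : Set ℂ), Quad.StrictlyDominated Q' Q₀ ∧ Quad.StrictlyDominated Q₀ Q'' ∧
        ∃ δ₀ : ℝ, 0 < δ₀ ∧ ∀ δ : ℝ, 0 < δ → δ < δ₀ →
          bondPercolation (zdGraph 2) half
            {ω | (∃ K, Q'.IsCrossing K ∧ K ⊆ openEdgeUnion δ ω) ∧
              ¬ ∃ K, Q''.IsCrossing K ∧ K ⊆ openEdgeUnion δ ω} ≤ ε) :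
    dkkmo_crossing_rotation_invariance := by
  refine dkkmo_crossing_rotation_invariance_of_schrammSmirnov (fun ε hε N hN hdiag => ?_) hcont
  haveI : CompactSpace (QuadCrossingSpace (univ : Set ℂ)) :=
    (SchrammSmirnov2011_thm_1_4_holds univ isOpen_univ univ_nonempty).1.1
  -- a positive `ε₁` with `{d < ε₁} ⊆ N`
  obtain ⟨ε₁, hε₁, hsub⟩ : ∃ ε₁ : ℝ, 0 < ε₁ ∧ ∀ p : QuadCrossingSpace (univ : Set ℂ) ×
      QuadCrossingSpace (univ : Set ℂ), d p.1 p.2 < ε₁ → p ∈ N := by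
    by_cases hF : (Nᶜ : Set _).Nonempty
    · obtain ⟨p₀, hp₀, hmin⟩ := hN.isClosed_compl.isCompact.exists_isMinOn hF hdc.continuousOn
      have hp₀pos : 0 < d p₀.1 p₀.2 := by
        refine hdpos _ _ fun heq => hp₀ ?_
        have : p₀ = (p₀.1, p₀.1) := Prod.ext rfl heq.symm
        rw [this]; exact hdiag _
      refine ⟨d p₀.1 p₀.2, hp₀pos, fun p hp => ?_⟩
      by_contra hpN
      exact (not_le.2 hp) (hmin hpN)
    · exact ⟨1, one_pos, fun p _ => by by_contra hpN; exact hF ⟨p, hpN⟩⟩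
  have hε' : 0 < min ε (ε₁ / 2) := lt_min hε (by linarith)
  obtain ⟨δ₀, hδ₀, H⟩ := hSSd (min ε (ε₁ / 2)) hε'
  refine ⟨δ₀, hδ₀, fun α hα δ hδ hδ₀' => ?_⟩
  have hα' : α ∈ Set.Ioo (min ε (ε₁ / 2)) (Real.pi - min ε (ε₁ / 2)) :=
    ⟨(min_le_left _ _).trans_lt hα.1, hα.2.trans_le (by linarith [min_le_left ε (ε₁ / 2)])⟩
  obtain ⟨P, h1, h2, hP⟩ := H α hα' δ hδ hδ₀'
  refine ⟨P, h1, h2, ((measure_mono fun p hp => ?_).trans_lt hP).trans_le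
    (ENNReal.ofReal_le_ofReal (min_le_left _ _))⟩
  show min ε (ε₁ / 2) < d _ _
  by_contra hle
  exact hp (hsub _ ((not_lt.1 hle).trans_lt (by linarith [min_le_right ε (ε₁ / 2)])))

end Literature.Probability.Percolation
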